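import Summits.HodgeConjecture.HodgeConjecture.Theorems.Ring2WeilCoverageCMFieldCarrierInstances
import Summits.HodgeConjecture.HodgeConjecture.Theorems.Ring2WeilCoverageCMFieldCarrierInstancesBiquadratic
import HarnessLib

/-!
# Ring 2 — Weil-type family-coverage census, CM-field rows (X-AY): the quartic CM subfields of the atlas
# cyclotomic field(s) `ℚ(ζ₂₄) ⊂ ℚ(ζ₄₈)` OUTSIDE the seven census tables —
# `ℚ(i,√6)`, `ℚ(√-2,√3)`, `ℚ(√-3,√2)`, `ℚ(√-2,√-3)`, `ℚ(√-3(2+√2))` —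
# their carriers, and on EVERY row `W8.E.δ` of their tables a CM eightfold with HC in the kernel

HONEST FRAMING: research route conditional on HC_CM; not a corollary; Q11.4-sentence-2 already refuted in dim ≥ 3.

Cell `pub-hodge-ring2`, seat `ring2-b03` (gen 64), census `WEIL-FAMILY-COVERAGE.md` «## b03», open cells (viii′)/(xii′) of b03.19/b03.20
(«the non-census quartic CM subfields of `ℚ(ζ₂₄)`, `ℚ(ζ₄₀)`, `ℚ(ζ₆₀)`»): the cyclic-cover (`ℤ/m`-Prym) eightfolds of the atlas with
`m ∈ {24, 40, 48, 60}` carry, besides the census fields, Weil-type `(2,2;2,2)` structures for FOURTEEN further quartic CM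
fields `K' ⊂ ℚ(ζ_m)` (eleven biquadratic, three cyclic of conductors `40`, `48`, `60`); this part treats the five new subfields of `ℚ(ζ₄₈)`: the four biquadratic subfields `ℚ(i,√6)`, `ℚ(√-2,√3)`, `ℚ(√-3,√2)`, `ℚ(√-2,√-3)` of `ℚ(ζ₂₄)` and the cyclic field `ℚ(√-3(2+√2))` of conductor `48`.
Exactly as parts X-L / X-M (`Ring2WeilCoverageCMFieldCarrierInstances{,Biquadratic}`, which rest on part X-K): for each carrier
`R = S² + pS + q` — `E = cmField R = ℚ(η)`, `η⁴ + pη² + q = 0` — the twist `η'` with `η'² + η² + p = 0` (so `E/ℚ` is Galois),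
for a biquadratic field a square root `i ∈ E` of `-c` (so `ℚ(√-c) ⊂ E`; member `B⁴`, `B ~ C₁²` of the CM type induced from
`ℚ(√-c)`, HC by Hazama / Pohlmann in the kernel), for a cyclic field the order-`4` substitution `u` with `u(η) = η'`,
`u(η') = -η` (member `B⁴`, `B` a SIMPLE CM surface, HC by Pohlmann in the kernel); all checked by `linear_combination`
against `η⁴ + pη² + q = 0`:

| field `E` | carrier `(p,q)` | `η'` | `c` / `u` | `i`, `i² = -c` |
|---|---|---|---|---|
| `ℚ(i,√6)` (η = i(1+√6)) | `(14,25)` | `-(η³ + 14η)/5` | `1` | `-(η³ + 9η)/10` |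
| `ℚ(√-2,√3)` (η = √-2(1+√3)) | `(16,16)` | `-(η³ + 16η)/4` | `2` | `-(η³ + 12η)/8` |
| `ℚ(√-3,√2)` (η = √-3(1+√2)) | `(18,9)` | `-(η³ + 18η)/3` | `3` | `-(η³ + 15η)/6` |
| `ℚ(√-2,√-3)` (η = √-2 + √-3) | `(10,1)` | `-η³ - 10η` | `2` | `-(η³ + 9η)/2` |
| `ℚ(√-3(2+√2))` (η² = -3(2+√2); cyclic, conductor 48) | `(12,18)` | `(η³ + 9η)/3` | `u = (T³ + 9T)/3` | — |

THEOREMS ONLY: no `def`, no named fact, no `sorry`; `HC_CM` does not occur. HONEST COLUMN: named CM members only;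
nothing at the general member of any row (crux stmt-1076); the sign of `δ` is not recorded by `IsPolarizationClass`.

## References
* [Deligne1982HodgeCycles] P. Deligne (notes by J. S. Milne), *Hodge cycles on abelian varieties*, LNM 900 (1982), §4, §5 (c).
* [Gordon1999HodgeAVSurvey] B. Gordon, Appendix B to Lewis, *A survey of the Hodge conjecture* (1999), Thm. 6.4 (Hazama).
* [Pohlmann1968] H. Pohlmann, Ann. of Math. 88 (1968), Thm. 1. [Shimura1998] G. Shimura, *Abelian Varieties with Complex
  Multiplication and Modular Functions* (1998), §8 Ex. 8.4 (2).
-/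

noncomputable section

set_option linter.dupNamespace false

namespace Summit.HodgeConjecture.HodgeConjecture.Ring2.WeilCoverageCM

open CategoryTheory CategoryTheory.Limits Polynomial NumberField
open Literature.AlgebraicGeometry Literature.AlgebraicGeometry.Motives Literature.AlgebraicGeometry.HodgeTheory
open Literature.AlgebraicGeometry.ComplexMultiplication Literature.AlgebraicGeometry.Deligne1982
open Literature.AlgebraicGeometry.Milne1999
open Summit.HodgeConjecture.HodgeConjecture.Ring2.Hypotheses (RosatiCompatible)

/-! ## §0 Non-square discriminants `p² - 4q = n·m²`, `n` not a perfect square (`n = 6, 10, 15`) -/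

/-- `n` strictly between two consecutive squares is not a perfect square. [folklore] -/
theorem not_isSquare_of_sq_lt_of_lt_sq {n k : ℕ} (h1 : k ^ 2 < n) (h2 : n < (k + 1) ^ 2) : ¬ IsSquare n := by
  rintro ⟨r, rfl⟩
  rw [sq] at h1 h2
  rcases le_or_gt r k with h | h
  · exact absurd (Nat.mul_le_mul h h) (not_le.2 h1)
  · exact absurd (Nat.mul_le_mul h h) (not_le.2 h2)

/-- A rational square is never `n` times a non-zero rational square when `n ∈ ℕ` is not a perfect square
(`√n ∉ ℚ`). [folklore] -/
theorem rat_sq_ne_nonsquare_mul_sq {n : ℕ} (hn : ¬ IsSquare n) {m : ℚ} (hm : m ≠ 0) (r : ℚ) :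
    r ^ 2 ≠ n * m ^ 2 := by
  intro h
  have hsq : IsSquare ((n : ℕ) : ℚ) := ⟨r / m, by field_simp; linear_combination -h⟩
  exact hn (Rat.isSquare_natCast_iff.1 hsq)

/-- The discriminant `p² - 4q` of a carrier is `n` times a non-zero square with `n` not a perfect square, hence not
a rational square. [folklore] -/
theorem not_sq_of_eq_nonsquare_mul_sq {p q : ℤ} {n : ℕ} (hn : ¬ IsSquare n) {m : ℚ} (hm : m ≠ 0)
    (h : (p : ℚ) ^ 2 - 4 * q = n * m ^ 2) : ∀ r : ℚ, r ^ 2 ≠ (p : ℚ) ^ 2 - 4 * q := by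
  intro r
  rw [h]
  exact rat_sq_ne_nonsquare_mul_sq hn hm r

/-! ## §1 `ℚ(i,√6)`: `R = S² + 14S + 25` (`η = i(1+√6)`), biquadratic, `ℚ(i) ⊂ E` -/

section SqrtNeg1Sqrt6

variable {R : Polynomial ℤ}

/-- The `Fact` for `E = ℚ(i,√6) = ℚ[T]/(T⁴ + 14T² + 25)` (discriminant `96 = 6·4²`). [folklore] -/
theorem sqrtNeg1Sqrt6_fact_cmPolyQ (hR : R = X ^ 2 + C 14 * X + C 25) : Fact (Irreducible (cmPolyQ R)) :=
  fact_irreducible_cmPolyQ_of_pos hR (by norm_num) (by norm_num)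
    (not_sq_of_eq_nonsquare_mul_sq (n := 6) (not_isSquare_of_sq_lt_of_lt_sq (k := 2) (by norm_num) (by norm_num)) (m := 4)
      (by norm_num) (by norm_num))

/-- In `ℚ(i,√6)`: `η' = -(η³ + 14η)/5 = 5η⁻¹` satisfies `η'² + η² + 14 = 0`. [folklore] -/
theorem sqrtNeg1Sqrt6_twist_sq (hR : R = X ^ 2 + C 14 * X + C 25) [Fact (Irreducible (cmPolyQ R))] :
    (-(cmRoot R ^ 3 + 14 * cmRoot R) / 5) ^ 2 + cmRoot R ^ 2 + ((14 : ℤ) : cmField R) = 0 := by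
  have ht := cmRoot_quartic R hR
  push_cast at ht ⊢
  linear_combination (cmRoot R ^ 2 / 25 + 14 / 25) * ht

/-- In `ℚ(i,√6)`: `i = -(η³ + 9η)/10` satisfies `i² + 1 = 0`. [folklore] -/
theorem sqrtNeg1Sqrt6_sqrtNegOne_sq (hR : R = X ^ 2 + C 14 * X + C 25) [Fact (Irreducible (cmPolyQ R))] :
    (-(cmRoot R ^ 3 + 9 * cmRoot R) / 10) ^ 2 + ((1 : ℤ) : cmField R) = 0 := by
  have ht := cmRoot_quartic R hR
  push_cast at ht ⊢
  linear_combination (cmRoot R ^ 2 / 100 + 1 / 25) * ht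

/-- **`ℚ(i,√6)/ℚ` is Galois.** [folklore] -/
theorem sqrtNeg1Sqrt6_isGalois (hR : R = X ^ 2 + C 14 * X + C 25) [Fact (Irreducible (cmPolyQ R))] :
    IsGalois ℚ (cmField R) :=
  isGalois_of_sq_add R hR _ (sqrtNeg1Sqrt6_twist_sq hR)

/-- **The rows `W8.ℚ(i,√6).δ`: on EVERY row a CM eightfold with HC in the kernel** (`B⁴`, `B ~ C₁²`, `C₁` an elliptic
curve with CM by `ℚ(i)`). [cite: Gordon1999HodgeAVSurvey, Thm. 6.4] [cite: Deligne1982HodgeCycles, §5 (c) pp. 38–39] -/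
theorem sqrtNeg1Sqrt6_carrier_rows_hodgeConjectureFor (hR : R = X ^ 2 + C 14 * X + C 25)
    [Fact (Irreducible (realPolyQ R))] (δ : cmNormResidueGroup R) :
    ∃ (A : AbelianVariety ℂ) (η : A ⟶ A) (h : complexBetti A.X 2),
      A.dim = 8 ∧ IsOfCMType A ∧ IsWeilTypeCM A η R 2 2 ∧ IsPolarizationClass A.dim A.X h ∧ RosatiCompatible A η h ∧
      HasWeilDiscriminantCM A η R 2 2 h δ ∧ HodgeConjectureFor A.dim A.X ∧
      weilClassesField A η (R.comp (X ^ 2)) (2 * 2) ≤ algebraicClasses A.X 2 := by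
  haveI := sqrtNeg1Sqrt6_fact_cmPolyQ hR
  exact carrier_exists_cmEightfold_hodgeConjectureFor_of_sqrt R hR
    (roots_real_neg_of_quadratic hR (by norm_num) (by norm_num) (by norm_num)) _ (sqrtNeg1Sqrt6_twist_sq hR)
    one_pos _ (sqrtNeg1Sqrt6_sqrtNegOne_sq hR) δ

/-- **All ranks over `ℚ(i,√6)`: rows `W_{4n}.E.δ`, every `n ≥ 1` (`g = 4, 8, 12, …`), every `δ`** — a CM member of
induced type (from `ℚ(i)`), Weil type of `E`-rank `2n`, polarization class of discriminant `δ`, HC in the kernel,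
`W_E ⊗ ℂ` algebraic. [cite: Gordon1999HodgeAVSurvey, Thm. 6.4] [cite: Deligne1982HodgeCycles, §5 (c) pp. 38–39] -/
theorem sqrtNeg1Sqrt6_carrier_allRanks_hodgeConjectureFor (hR : R = X ^ 2 + C 14 * X + C 25)
    [Fact (Irreducible (realPolyQ R))] {n : ℕ} (hn : 0 < n) (δ : cmNormResidueGroup R) :
    ∃ (A : AbelianVariety ℂ) (η : A ⟶ A) (h : complexBetti A.X 2),
      IsOfCMType A ∧ IsWeilTypeCM A η R 2 n ∧ IsPolarizationClass A.dim A.X h ∧ RosatiCompatible A η h ∧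
      HasWeilDiscriminantCM A η R 2 n h δ ∧ HodgeConjectureFor A.dim A.X ∧
      weilClassesField A η (R.comp (X ^ 2)) (2 * n) ≤ algebraicClasses A.X n := by
  haveI := sqrtNeg1Sqrt6_fact_cmPolyQ hR
  exact carrier_exists_cmMember_hodgeConjectureFor_of_sqrt R hR
    (roots_real_neg_of_quadratic hR (by norm_num) (by norm_num) (by norm_num)) _ (sqrtNeg1Sqrt6_twist_sq hR)
    one_pos _ (sqrtNeg1Sqrt6_sqrtNegOne_sq hR) hn δ

end SqrtNeg1Sqrt6

/-! ## §2 `ℚ(√-2,√3)`: `R = S² + 16S + 16` (`η = √-2(1+√3)`), biquadratic, `ℚ(√-2) ⊂ E` -/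

section SqrtNeg2Sqrt3

variable {R : Polynomial ℤ}

/-- The `Fact` for `E = ℚ(√-2,√3) = ℚ[T]/(T⁴ + 16T² + 16)` (discriminant `192 = 3·8²`). [folklore] -/
theorem sqrtNeg2Sqrt3_fact_cmPolyQ (hR : R = X ^ 2 + C 16 * X + C 16) : Fact (Irreducible (cmPolyQ R)) :=
  fact_irreducible_cmPolyQ_of_pos hR (by norm_num) (by norm_num)
    (not_sq_of_eq_prime_mul_sq (ℓ := 3) Nat.prime_three (m := 8) (by norm_num) (by norm_num))

/-- In `ℚ(√-2,√3)`: `η' = -(η³ + 16η)/4 = 4η⁻¹` satisfies `η'² + η² + 16 = 0`. [folklore] -/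
theorem sqrtNeg2Sqrt3_twist_sq (hR : R = X ^ 2 + C 16 * X + C 16) [Fact (Irreducible (cmPolyQ R))] :
    (-(cmRoot R ^ 3 + 16 * cmRoot R) / 4) ^ 2 + cmRoot R ^ 2 + ((16 : ℤ) : cmField R) = 0 := by
  have ht := cmRoot_quartic R hR
  push_cast at ht ⊢
  linear_combination (cmRoot R ^ 2 / 16 + 1) * ht

/-- In `ℚ(√-2,√3)`: `i = -(η³ + 12η)/8` satisfies `i² + 2 = 0`. [folklore] -/
theorem sqrtNeg2Sqrt3_sqrtNegTwo_sq (hR : R = X ^ 2 + C 16 * X + C 16) [Fact (Irreducible (cmPolyQ R))] :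
    (-(cmRoot R ^ 3 + 12 * cmRoot R) / 8) ^ 2 + ((2 : ℤ) : cmField R) = 0 := by
  have ht := cmRoot_quartic R hR
  push_cast at ht ⊢
  linear_combination (cmRoot R ^ 2 / 64 + 1 / 8) * ht

/-- **`ℚ(√-2,√3)/ℚ` is Galois.** [folklore] -/
theorem sqrtNeg2Sqrt3_isGalois (hR : R = X ^ 2 + C 16 * X + C 16) [Fact (Irreducible (cmPolyQ R))] :
    IsGalois ℚ (cmField R) :=
  isGalois_of_sq_add R hR _ (sqrtNeg2Sqrt3_twist_sq hR)

/-- **The rows `W8.ℚ(√-2,√3).δ`: on EVERY row a CM eightfold with HC in the kernel** (`B⁴`, `B ~ C₁²`, `C₁` an elliptic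
curve with CM by `ℚ(√-2)`). [cite: Gordon1999HodgeAVSurvey, Thm. 6.4] [cite: Deligne1982HodgeCycles, §5 (c) pp. 38–39] -/
theorem sqrtNeg2Sqrt3_carrier_rows_hodgeConjectureFor (hR : R = X ^ 2 + C 16 * X + C 16)
    [Fact (Irreducible (realPolyQ R))] (δ : cmNormResidueGroup R) :
    ∃ (A : AbelianVariety ℂ) (η : A ⟶ A) (h : complexBetti A.X 2),
      A.dim = 8 ∧ IsOfCMType A ∧ IsWeilTypeCM A η R 2 2 ∧ IsPolarizationClass A.dim A.X h ∧ RosatiCompatible A η h ∧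
      HasWeilDiscriminantCM A η R 2 2 h δ ∧ HodgeConjectureFor A.dim A.X ∧
      weilClassesField A η (R.comp (X ^ 2)) (2 * 2) ≤ algebraicClasses A.X 2 := by
  haveI := sqrtNeg2Sqrt3_fact_cmPolyQ hR
  exact carrier_exists_cmEightfold_hodgeConjectureFor_of_sqrt R hR
    (roots_real_neg_of_quadratic hR (by norm_num) (by norm_num) (by norm_num)) _ (sqrtNeg2Sqrt3_twist_sq hR)
    (by norm_num) _ (sqrtNeg2Sqrt3_sqrtNegTwo_sq hR) δ

/-- **All ranks over `ℚ(√-2,√3)`: rows `W_{4n}.E.δ`, every `n ≥ 1` (`g = 4, 8, 12, …`), every `δ`** — a CM member of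
induced type (from `ℚ(√-2)`), Weil type of `E`-rank `2n`, polarization class of discriminant `δ`, HC in the kernel,
`W_E ⊗ ℂ` algebraic. [cite: Gordon1999HodgeAVSurvey, Thm. 6.4] [cite: Deligne1982HodgeCycles, §5 (c) pp. 38–39] -/
theorem sqrtNeg2Sqrt3_carrier_allRanks_hodgeConjectureFor (hR : R = X ^ 2 + C 16 * X + C 16)
    [Fact (Irreducible (realPolyQ R))] {n : ℕ} (hn : 0 < n) (δ : cmNormResidueGroup R) :
    ∃ (A : AbelianVariety ℂ) (η : A ⟶ A) (h : complexBetti A.X 2),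
      IsOfCMType A ∧ IsWeilTypeCM A η R 2 n ∧ IsPolarizationClass A.dim A.X h ∧ RosatiCompatible A η h ∧
      HasWeilDiscriminantCM A η R 2 n h δ ∧ HodgeConjectureFor A.dim A.X ∧
      weilClassesField A η (R.comp (X ^ 2)) (2 * n) ≤ algebraicClasses A.X n := by
  haveI := sqrtNeg2Sqrt3_fact_cmPolyQ hR
  exact carrier_exists_cmMember_hodgeConjectureFor_of_sqrt R hR
    (roots_real_neg_of_quadratic hR (by norm_num) (by norm_num) (by norm_num)) _ (sqrtNeg2Sqrt3_twist_sq hR)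
    (by norm_num) _ (sqrtNeg2Sqrt3_sqrtNegTwo_sq hR) hn δ

end SqrtNeg2Sqrt3

/-! ## §3 `ℚ(√-3,√2)`: `R = S² + 18S + 9` (`η = √-3(1+√2)`), biquadratic, `ℚ(√-3) ⊂ E` -/

section SqrtNeg3Sqrt2

variable {R : Polynomial ℤ}

/-- The `Fact` for `E = ℚ(√-3,√2) = ℚ[T]/(T⁴ + 18T² + 9)` (discriminant `288 = 2·12²`). [folklore] -/
theorem sqrtNeg3Sqrt2_fact_cmPolyQ (hR : R = X ^ 2 + C 18 * X + C 9) : Fact (Irreducible (cmPolyQ R)) :=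
  fact_irreducible_cmPolyQ_of_pos hR (by norm_num) (by norm_num)
    (not_sq_of_eq_prime_mul_sq (ℓ := 2) Nat.prime_two (m := 12) (by norm_num) (by norm_num))

/-- In `ℚ(√-3,√2)`: `η' = -(η³ + 18η)/3 = 3η⁻¹` satisfies `η'² + η² + 18 = 0`. [folklore] -/
theorem sqrtNeg3Sqrt2_twist_sq (hR : R = X ^ 2 + C 18 * X + C 9) [Fact (Irreducible (cmPolyQ R))] :
    (-(cmRoot R ^ 3 + 18 * cmRoot R) / 3) ^ 2 + cmRoot R ^ 2 + ((18 : ℤ) : cmField R) = 0 := by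
  have ht := cmRoot_quartic R hR
  push_cast at ht ⊢
  linear_combination (cmRoot R ^ 2 / 9 + 2) * ht

/-- In `ℚ(√-3,√2)`: `i = -(η³ + 15η)/6` satisfies `i² + 3 = 0`. [folklore] -/
theorem sqrtNeg3Sqrt2_sqrtNegThree_sq (hR : R = X ^ 2 + C 18 * X + C 9) [Fact (Irreducible (cmPolyQ R))] :
    (-(cmRoot R ^ 3 + 15 * cmRoot R) / 6) ^ 2 + ((3 : ℤ) : cmField R) = 0 := by
  have ht := cmRoot_quartic R hR
  push_cast at ht ⊢
  linear_combination (cmRoot R ^ 2 / 36 + 1 / 3) * ht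

/-- **`ℚ(√-3,√2)/ℚ` is Galois.** [folklore] -/
theorem sqrtNeg3Sqrt2_isGalois (hR : R = X ^ 2 + C 18 * X + C 9) [Fact (Irreducible (cmPolyQ R))] :
    IsGalois ℚ (cmField R) :=
  isGalois_of_sq_add R hR _ (sqrtNeg3Sqrt2_twist_sq hR)

/-- **The rows `W8.ℚ(√-3,√2).δ`: on EVERY row a CM eightfold with HC in the kernel** (`B⁴`, `B ~ C₁²`, `C₁` an elliptic
curve with CM by `ℚ(√-3)`). [cite: Gordon1999HodgeAVSurvey, Thm. 6.4] [cite: Deligne1982HodgeCycles, §5 (c) pp. 38–39] -/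
theorem sqrtNeg3Sqrt2_carrier_rows_hodgeConjectureFor (hR : R = X ^ 2 + C 18 * X + C 9)
    [Fact (Irreducible (realPolyQ R))] (δ : cmNormResidueGroup R) :
    ∃ (A : AbelianVariety ℂ) (η : A ⟶ A) (h : complexBetti A.X 2),
      A.dim = 8 ∧ IsOfCMType A ∧ IsWeilTypeCM A η R 2 2 ∧ IsPolarizationClass A.dim A.X h ∧ RosatiCompatible A η h ∧
      HasWeilDiscriminantCM A η R 2 2 h δ ∧ HodgeConjectureFor A.dim A.X ∧
      weilClassesField A η (R.comp (X ^ 2)) (2 * 2) ≤ algebraicClasses A.X 2 := by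
  haveI := sqrtNeg3Sqrt2_fact_cmPolyQ hR
  exact carrier_exists_cmEightfold_hodgeConjectureFor_of_sqrt R hR
    (roots_real_neg_of_quadratic hR (by norm_num) (by norm_num) (by norm_num)) _ (sqrtNeg3Sqrt2_twist_sq hR)
    (by norm_num) _ (sqrtNeg3Sqrt2_sqrtNegThree_sq hR) δ

/-- **All ranks over `ℚ(√-3,√2)`: rows `W_{4n}.E.δ`, every `n ≥ 1` (`g = 4, 8, 12, …`), every `δ`** — a CM member of
induced type (from `ℚ(√-3)`), Weil type of `E`-rank `2n`, polarization class of discriminant `δ`, HC in the kernel,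
`W_E ⊗ ℂ` algebraic. [cite: Gordon1999HodgeAVSurvey, Thm. 6.4] [cite: Deligne1982HodgeCycles, §5 (c) pp. 38–39] -/
theorem sqrtNeg3Sqrt2_carrier_allRanks_hodgeConjectureFor (hR : R = X ^ 2 + C 18 * X + C 9)
    [Fact (Irreducible (realPolyQ R))] {n : ℕ} (hn : 0 < n) (δ : cmNormResidueGroup R) :
    ∃ (A : AbelianVariety ℂ) (η : A ⟶ A) (h : complexBetti A.X 2),
      IsOfCMType A ∧ IsWeilTypeCM A η R 2 n ∧ IsPolarizationClass A.dim A.X h ∧ RosatiCompatible A η h ∧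
      HasWeilDiscriminantCM A η R 2 n h δ ∧ HodgeConjectureFor A.dim A.X ∧
      weilClassesField A η (R.comp (X ^ 2)) (2 * n) ≤ algebraicClasses A.X n := by
  haveI := sqrtNeg3Sqrt2_fact_cmPolyQ hR
  exact carrier_exists_cmMember_hodgeConjectureFor_of_sqrt R hR
    (roots_real_neg_of_quadratic hR (by norm_num) (by norm_num) (by norm_num)) _ (sqrtNeg3Sqrt2_twist_sq hR)
    (by norm_num) _ (sqrtNeg3Sqrt2_sqrtNegThree_sq hR) hn δ

end SqrtNeg3Sqrt2

/-! ## §4 `ℚ(√-2,√-3)`: `R = S² + 10S + 1` (`η = √-2 + √-3`), biquadratic, `ℚ(√-2) ⊂ E` -/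

section SqrtNeg2SqrtNeg3

variable {R : Polynomial ℤ}

/-- The `Fact` for `E = ℚ(√-2,√-3) = ℚ[T]/(T⁴ + 10T² + 1)` (discriminant `96 = 6·4²`). [folklore] -/
theorem sqrtNeg2SqrtNeg3_fact_cmPolyQ (hR : R = X ^ 2 + C 10 * X + C 1) : Fact (Irreducible (cmPolyQ R)) :=
  fact_irreducible_cmPolyQ_of_pos hR (by norm_num) (by norm_num)
    (not_sq_of_eq_nonsquare_mul_sq (n := 6) (not_isSquare_of_sq_lt_of_lt_sq (k := 2) (by norm_num) (by norm_num)) (m := 4)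
      (by norm_num) (by norm_num))

/-- In `ℚ(√-2,√-3)`: `η' = -η³ - 10η = η⁻¹` satisfies `η'² + η² + 10 = 0`. [folklore] -/
theorem sqrtNeg2SqrtNeg3_twist_sq (hR : R = X ^ 2 + C 10 * X + C 1) [Fact (Irreducible (cmPolyQ R))] :
    (-cmRoot R ^ 3 - 10 * cmRoot R) ^ 2 + cmRoot R ^ 2 + ((10 : ℤ) : cmField R) = 0 := by
  have ht := cmRoot_quartic R hR
  push_cast at ht ⊢
  linear_combination (cmRoot R ^ 2 + 10) * ht

/-- In `ℚ(√-2,√-3)`: `i = -(η³ + 9η)/2` satisfies `i² + 2 = 0`. [folklore] -/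
theorem sqrtNeg2SqrtNeg3_sqrtNegTwo_sq (hR : R = X ^ 2 + C 10 * X + C 1) [Fact (Irreducible (cmPolyQ R))] :
    (-(cmRoot R ^ 3 + 9 * cmRoot R) / 2) ^ 2 + ((2 : ℤ) : cmField R) = 0 := by
  have ht := cmRoot_quartic R hR
  push_cast at ht ⊢
  linear_combination (cmRoot R ^ 2 / 4 + 2) * ht

/-- **`ℚ(√-2,√-3)/ℚ` is Galois.** [folklore] -/
theorem sqrtNeg2SqrtNeg3_isGalois (hR : R = X ^ 2 + C 10 * X + C 1) [Fact (Irreducible (cmPolyQ R))] :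
    IsGalois ℚ (cmField R) :=
  isGalois_of_sq_add R hR _ (sqrtNeg2SqrtNeg3_twist_sq hR)

/-- **The rows `W8.ℚ(√-2,√-3).δ`: on EVERY row a CM eightfold with HC in the kernel** (`B⁴`, `B ~ C₁²`, `C₁` an elliptic
curve with CM by `ℚ(√-2)`). [cite: Gordon1999HodgeAVSurvey, Thm. 6.4] [cite: Deligne1982HodgeCycles, §5 (c) pp. 38–39] -/
theorem sqrtNeg2SqrtNeg3_carrier_rows_hodgeConjectureFor (hR : R = X ^ 2 + C 10 * X + C 1)
    [Fact (Irreducible (realPolyQ R))] (δ : cmNormResidueGroup R) :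
    ∃ (A : AbelianVariety ℂ) (η : A ⟶ A) (h : complexBetti A.X 2),
      A.dim = 8 ∧ IsOfCMType A ∧ IsWeilTypeCM A η R 2 2 ∧ IsPolarizationClass A.dim A.X h ∧ RosatiCompatible A η h ∧
      HasWeilDiscriminantCM A η R 2 2 h δ ∧ HodgeConjectureFor A.dim A.X ∧
      weilClassesField A η (R.comp (X ^ 2)) (2 * 2) ≤ algebraicClasses A.X 2 := by
  haveI := sqrtNeg2SqrtNeg3_fact_cmPolyQ hR
  exact carrier_exists_cmEightfold_hodgeConjectureFor_of_sqrt R hR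
    (roots_real_neg_of_quadratic hR (by norm_num) (by norm_num) (by norm_num)) _ (sqrtNeg2SqrtNeg3_twist_sq hR)
    (by norm_num) _ (sqrtNeg2SqrtNeg3_sqrtNegTwo_sq hR) δ

/-- **All ranks over `ℚ(√-2,√-3)`: rows `W_{4n}.E.δ`, every `n ≥ 1` (`g = 4, 8, 12, …`), every `δ`** — a CM member of
induced type (from `ℚ(√-2)`), Weil type of `E`-rank `2n`, polarization class of discriminant `δ`, HC in the kernel,
`W_E ⊗ ℂ` algebraic. [cite: Gordon1999HodgeAVSurvey, Thm. 6.4] [cite: Deligne1982HodgeCycles, §5 (c) pp. 38–39] -/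
theorem sqrtNeg2SqrtNeg3_carrier_allRanks_hodgeConjectureFor (hR : R = X ^ 2 + C 10 * X + C 1)
    [Fact (Irreducible (realPolyQ R))] {n : ℕ} (hn : 0 < n) (δ : cmNormResidueGroup R) :
    ∃ (A : AbelianVariety ℂ) (η : A ⟶ A) (h : complexBetti A.X 2),
      IsOfCMType A ∧ IsWeilTypeCM A η R 2 n ∧ IsPolarizationClass A.dim A.X h ∧ RosatiCompatible A η h ∧
      HasWeilDiscriminantCM A η R 2 n h δ ∧ HodgeConjectureFor A.dim A.X ∧
      weilClassesField A η (R.comp (X ^ 2)) (2 * n) ≤ algebraicClasses A.X n := by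
  haveI := sqrtNeg2SqrtNeg3_fact_cmPolyQ hR
  exact carrier_exists_cmMember_hodgeConjectureFor_of_sqrt R hR
    (roots_real_neg_of_quadratic hR (by norm_num) (by norm_num) (by norm_num)) _ (sqrtNeg2SqrtNeg3_twist_sq hR)
    (by norm_num) _ (sqrtNeg2SqrtNeg3_sqrtNegTwo_sq hR) hn δ

end SqrtNeg2SqrtNeg3

/-! ## §5 `ℚ(√-3(2+√2))`: `R = S² + 12S + 18` (`η² = -3(2+√2)`), CYCLIC (conductor 48) -/

section SqrtNegThreeTimesTwoPlusSqrtTwo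

variable {R : Polynomial ℤ}

/-- The `Fact` for `E = ℚ(√-3(2+√2)) = ℚ[T]/(T⁴ + 12T² + 18)` (discriminant `72 = 2·6²`). [folklore] -/
theorem sqrtNegThreeTimesTwoPlusSqrtTwo_fact_cmPolyQ (hR : R = X ^ 2 + C 12 * X + C 18) : Fact (Irreducible (cmPolyQ R)) :=
  fact_irreducible_cmPolyQ_of_pos hR (by norm_num) (by norm_num)
    (not_sq_of_eq_prime_mul_sq (ℓ := 2) Nat.prime_two (m := 6) (by norm_num) (by norm_num))

/-- In `ℚ(√-3(2+√2))`: `η' = (η³ + 9η)/3` satisfies `η'² + η² + 12 = 0` (`η η'` is `3√2 = -(η² + 6)`). [folklore] -/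
theorem sqrtNegThreeTimesTwoPlusSqrtTwo_twist_sq (hR : R = X ^ 2 + C 12 * X + C 18) [Fact (Irreducible (cmPolyQ R))] :
    ((cmRoot R ^ 3 + 9 * cmRoot R) / 3) ^ 2 + cmRoot R ^ 2 + ((12 : ℤ) : cmField R) = 0 := by
  have ht := cmRoot_quartic R hR
  push_cast at ht ⊢
  linear_combination (cmRoot R ^ 2 / 9 + 2 / 3) * ht

/-- **`ℚ(√-3(2+√2))/ℚ` is Galois.** [folklore] -/
theorem sqrtNegThreeTimesTwoPlusSqrtTwo_isGalois (hR : R = X ^ 2 + C 12 * X + C 18) [Fact (Irreducible (cmPolyQ R))] :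
    IsGalois ℚ (cmField R) :=
  isGalois_of_sq_add R hR _ (sqrtNegThreeTimesTwoPlusSqrtTwo_twist_sq hR)

/-- **`Gal(ℚ(√-3(2+√2))/ℚ)` is cyclic** (`σ : η ↦ (η³ + 9η)/3`, `σ²(η) = -η`). [folklore] -/
theorem sqrtNegThreeTimesTwoPlusSqrtTwo_isCyclic (hR : R = X ^ 2 + C 12 * X + C 18) [Fact (Irreducible (cmPolyQ R))] :
    IsCyclic (cmField R ≃ₐ[ℚ] cmField R) := by
  have ht := cmRoot_quartic R hR
  push_cast at ht
  refine isCyclic_of_sq_add R hR _ (sqrtNegThreeTimesTwoPlusSqrtTwo_twist_sq hR) (C (1 / 3 : ℚ) * (X ^ 3 + 9 * X)) ?_ ?_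
  · simp only [map_add, map_mul, map_pow, aeval_X, aeval_C, map_div₀, map_one, map_ofNat]
    ring
  · simp only [map_add, map_mul, map_pow, aeval_X, aeval_C, map_div₀, map_one, map_ofNat]
    linear_combination (cmRoot R ^ 5 / 81 + 5 / 27 * cmRoot R ^ 3 + 5 / 9 * cmRoot R) * ht

/-- **The rows `W8.ℚ(√-3(2+√2)).δ`: on EVERY row a CM eightfold with HC in the kernel** (`A ≅ B⁴`, `B` a SIMPLE CM
surface). [cite: Pohlmann1968, Thm. 1] [cite: Deligne1982HodgeCycles, §5 (c) pp. 38–39] -/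
theorem sqrtNegThreeTimesTwoPlusSqrtTwo_carrier_rows_hodgeConjectureFor (hR : R = X ^ 2 + C 12 * X + C 18)
    [Fact (Irreducible (realPolyQ R))] (δ : cmNormResidueGroup R) :
    ∃ (A : AbelianVariety ℂ) (η : A ⟶ A) (h : complexBetti A.X 2) (B : AbelianVariety ℂ),
      Nonempty (A ≅ ⨁ fun _ : Fin 4 => B) ∧ B.IsSimple ∧ B.dim = 2 ∧ IsOfCMType B ∧ A.dim = 8 ∧ IsOfCMType A ∧
      IsWeilTypeCM A η R 2 2 ∧ IsPolarizationClass A.dim A.X h ∧ RosatiCompatible A η h ∧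
      HasWeilDiscriminantCM A η R 2 2 h δ ∧ HodgeConjectureFor A.dim A.X ∧
      weilClassesField A η (R.comp (X ^ 2)) (2 * 2) ≤ algebraicClasses A.X 2 := by
  haveI := sqrtNegThreeTimesTwoPlusSqrtTwo_fact_cmPolyQ hR
  have hroots := roots_real_neg_of_quadratic hR (by norm_num) (by norm_num) (by norm_num)
  haveI : IsCMField (cmField R) := isCMField_cmField hroots
  haveI := sqrtNegThreeTimesTwoPlusSqrtTwo_isGalois hR
  obtain ⟨hRm, hRdeg⟩ := monic_and_natDegree_of_quadratic R hR
  exact carrier_exists_cmEightfold_hodgeConjectureFor_of_isCyclic R hRm hRdeg hroots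
    (sqrtNegThreeTimesTwoPlusSqrtTwo_isCyclic hR) δ

/-- **All ranks over `ℚ(√-3(2+√2))`: rows `W_{4n}.E.δ`, every `n ≥ 1`, every `δ`:** `B^{2n}`, `B` a SIMPLE CM surface,
Weil type of `E`-rank `2n`, polarization class of discriminant `δ`, HC in the kernel, `W_E ⊗ ℂ` algebraic.
[cite: Pohlmann1968, Thm. 1] [cite: Deligne1982HodgeCycles, §5 (c) pp. 38–39] -/
theorem sqrtNegThreeTimesTwoPlusSqrtTwo_carrier_allRanks_hodgeConjectureFor (hR : R = X ^ 2 + C 12 * X + C 18)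
    [Fact (Irreducible (realPolyQ R))] {n : ℕ} (hn : 0 < n) (δ : cmNormResidueGroup R) :
    ∃ (B : AbelianVariety ℂ) (η : (⨁ fun _ : Fin (2 * n) => B) ⟶ ⨁ fun _ : Fin (2 * n) => B)
      (h : complexBetti (⨁ fun _ : Fin (2 * n) => B).X 2),
      B.IsSimple ∧ B.dim = 2 ∧ IsOfCMType B ∧
      IsOfCMType (⨁ fun _ : Fin (2 * n) => B) ∧ IsWeilTypeCM (⨁ fun _ : Fin (2 * n) => B) η R 2 n ∧
      IsPolarizationClass (⨁ fun _ : Fin (2 * n) => B).dim (⨁ fun _ : Fin (2 * n) => B).X h ∧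
      RosatiCompatible (⨁ fun _ : Fin (2 * n) => B) η h ∧
      HasWeilDiscriminantCM (⨁ fun _ : Fin (2 * n) => B) η R 2 n h δ ∧
      HodgeConjectureFor (⨁ fun _ : Fin (2 * n) => B).dim (⨁ fun _ : Fin (2 * n) => B).X ∧
      weilClassesField (⨁ fun _ : Fin (2 * n) => B) η (R.comp (X ^ 2)) (2 * n) ≤
        algebraicClasses (⨁ fun _ : Fin (2 * n) => B).X n := by
  haveI := sqrtNegThreeTimesTwoPlusSqrtTwo_fact_cmPolyQ hR
  have hroots := roots_real_neg_of_quadratic hR (by norm_num) (by norm_num) (by norm_num)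
  haveI : IsCMField (cmField R) := isCMField_cmField hroots
  haveI := sqrtNegThreeTimesTwoPlusSqrtTwo_isGalois hR
  obtain ⟨hRm, hRdeg⟩ := monic_and_natDegree_of_quadratic R hR
  exact carrier_exists_simplePower_hodgeConjectureFor_of_isCyclic R hRm hRdeg le_rfl hroots
    (sqrtNegThreeTimesTwoPlusSqrtTwo_isCyclic hR) hn δ

end SqrtNegThreeTimesTwoPlusSqrtTwo

end Summit.HodgeConjecture.HodgeConjecture.Ring2.WeilCoverageCM

end
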